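import Literature.MathematicalPhysics.QuantumFieldTheory.BalabanImbrieJaffe1984to88.BIJ88Eq596Display

/-!
# `BalabanImbrieJaffe1984to88.BIJ88Eq596Passage` — T. Bałaban, J. Imbrie, A. Jaffe, *Effective action and cluster properties of the
abelian Higgs model*, Commun. Math. Phys. **114** (1988) 257–315 [BalabanImbrieJaffe1988], (5.3.1)/(5.3.6) p. 280 [PDF 24] for the one-integrand
displays of `BIJ88Eq596Display` (line 1 of (5.9.6) p. 297 [PDF 41]): **THE PASSAGE `IsRDG ↔ IsDT`** — the first gauge field translation
*"u = u′(Λ₁^{(k)*}Q^{s*}v) (5.3.1) … δ_{Ax}(u) = δ_{Ax}(u′), δ(v/Qu) = δ_{Λ₁^{(k)′*c}}(v/Qu) δ_{Λ₁^{(k)′*}}((e_k/2π)QA′) (5.3.6)"* as a change of variables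
for a GENERAL integrand, in both directions: a density satisfies the untranslated display `IsRDG ν terms Qu G` iff it satisfies line 1 of (5.9.6)
`IsDT ν terms Λ Qu J` with `J_t({u^{(j)}}, u′, v, φ, ψ) = G_t({u^{(j)}}, u′·Q^{s*}(cutoff_{Λ_t} v), φ, ψ)` — the old integrand read in the new variables
(`ν` a substitution-invariant probability law: `𝒟u δ_{Ax}`, `𝒟u`; the printed `Qu`; `fieldsMeasure ν`-integrable integrands; any cut-offs; standing
range).  Seat p34 gen 9, file 1b (split from file 1 for length); gen 8's `BIJ88RT53TranslCut.isRD_iff_isRDT` is the case `G = ρ·gaussWeight`.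

statement-level skeleton of published theorems with citation tags; proofs where landed; nothing here is a claim about the Yang–Mills mass gap

PDF held: `paper:balaban1988-cmp114-bij-abelian-higgs-effective-action` (journal page = PDF page + 256); p. 280 [PDF 24], p. 297 [PDF 41] re-read
this session (r16's renders `HOME/lit-balaban-r16/renders/cmp114/original-p024-x2.png`, `original-p041-x2.png`).
CITATION HEADER (lean-in-tree rule).  Part of the lit-balaban TYPED SKELETON (HOME `run/shared/lean/pub/lit-balaban/`), PHASE-2 proof seat p34
gen 9 (unit `lit-balaban-p34-g9`; TAKING line HOME/STATUS.md 2026-08-21T21:12:57Z; own lineage).  Rows served: support `C2.Eq5.3.1-5.3.7`,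
`C2.Eq5.9.6` (owner r16).

WHAT IS PROVED (theorems only; 0 `sorry`; standard axioms).  §1 Fubini plumbing (five-fold iterated integrals in the order of `IsDT`).  §2
`integral_fields_eq_iter_translCut`: `∫ν∫Π𝒟u^{(j)}∫𝒟φ∫dψ H(u, ·) = ∫dv′∫ν(du)∫Π𝒟u^{(j)}∫dψ∫𝒟φ H(u′_Λ(u)·Q^{s*}(cutoff_Λ v′), ·)` for every
`fieldsMeasure ν`-integrable `H` (gen 7's measure-preserving `(u, v′) ↦ u′_Λ(u)·Q^{s*}(cutoff_Λ v′)` on `ν ⊗ dv′`); `term_test_eq_translCut`; **`isDT_of_isRDG`**,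
**`isRDG_of_isDT`**, `isRDG_iff_isDT`; `isDT_of_isRD` (gen 8's display ⇒ line 1 of (5.9.6) with `J = ρ·gaussWeight`); instances `𝒟u δ_{Ax}`, `𝒟u`.
Imports `BIJ88Eq596Display` only (Literature + Mathlib).
-/

namespace Literature.MathematicalPhysics.QuantumFieldTheory.BalabanImbrieJaffe1984to88.BIJ88Eq596Passage

open Literature.MathematicalPhysics.QuantumFieldTheory.Balaban1983to89
open BIJ88Sect3Statements (U1)
open BIJ85Sect1Model (HiggsField)
open BIJ88RenormTransf311 (axialMeasure gaussWeight)
open BIJ88InductiveForm41 (Prev prevMeasure)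
open BIJ85BlockAveragesTorus (qU surfMul measurable_qU map_surfMul_fieldMeasure)
open BIJ88Eq536Linearization (cutoff)
open BIJ88Eq531TranslLaw (axialMeasure_map_surfMul)
open BIJ88Eq531TranslLawCutoff (measurePreserving_translCut)
open BIJ88RT52Restrictions (Fields fieldsMeasure IsRD integral_fieldsMeasure)
open BIJ88Eq596Display (uCut vCut IsRDG IsDT isRD_iff_isRDG qU_translCut' cutoff_vCut uCut_translCut translCut_uCut_qU)
open scoped BigOperators ENNReal
open _root_.MeasureTheory _root_.MeasureTheory.Measure Complex Function

noncomputable section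

variable {P : Params} {k : ℕ}

/-! ## §1 Fubini plumbing -/

section Fubini

variable {α β γ δ ε : Type*} [MeasurableSpace α] [MeasurableSpace β] [MeasurableSpace γ] [MeasurableSpace δ] [MeasurableSpace ε]
variable {μa : Measure α} {μb : Measure β} {μc : Measure γ} {μd : Measure δ} {μe : Measure ε}
variable [SFinite μa] [SFinite μb] [SFinite μc] [SFinite μd] [SFinite μe]
variable {E : Type*} [NormedAddCommGroup E] [NormedSpace ℝ E]

/-- kernel: three-fold Fubini with the two inner integrals swapped, `∫_{c⊗(d⊗e)} h = ∫c∫e∫d h`. [folklore] -/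
private theorem integral_prod₃_swap {h : γ × (δ × ε) → E} (hh : Integrable h (μc.prod (μd.prod μe))) :
    ∫ r, h r ∂μc.prod (μd.prod μe) = ∫ z, ∫ t, ∫ w, h (z, (w, t)) ∂μd ∂μe ∂μc := by
  rw [integral_prod _ hh]
  refine integral_congr_ae ?_
  filter_upwards [hh.prod_right_ae] with z hz
  rw [integral_prod _ hz]
  exact integral_integral_swap hz

/-- kernel: five-fold Fubini in the order `b, a, c, e, d`: `∫_{(a⊗b)⊗(c⊗(d⊗e))} K = ∫b∫a∫c∫e∫d K` for an integrable `K` (swap the first two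
factors by the measure-preserving `Prod.swap`, then as `integral_prod₅` with the two innermost integrals swapped). [folklore] -/
private theorem integral_prod₅_swap {K : (α × β) × (γ × (δ × ε)) → E} (hK : Integrable K ((μa.prod μb).prod (μc.prod (μd.prod μe)))) :
    ∫ q, K q ∂(μa.prod μb).prod (μc.prod (μd.prod μe)) =
      ∫ y, ∫ x, ∫ z, ∫ t, ∫ w, K ((x, y), (z, (w, t))) ∂μd ∂μe ∂μc ∂μa ∂μb := by
  have hS : MeasurePreserving (Prod.map (Prod.swap : β × α → α × β) (id : γ × (δ × ε) → γ × (δ × ε)))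
      ((μb.prod μa).prod (μc.prod (μd.prod μe))) ((μa.prod μb).prod (μc.prod (μd.prod μe))) :=
    (Measure.measurePreserving_swap (μ := μb) (ν := μa)).prod (MeasurePreserving.id _)
  have hK' : Integrable (K ∘ Prod.map Prod.swap id) ((μb.prod μa).prod (μc.prod (μd.prod μe))) :=
    (hS.integrable_comp hK.aestronglyMeasurable).2 hK
  have e1 : ∫ q, K q ∂(μa.prod μb).prod (μc.prod (μd.prod μe)) = ∫ q, (K ∘ Prod.map Prod.swap id) q ∂(μb.prod μa).prod (μc.prod (μd.prod μe)) := by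
    have hm : AEStronglyMeasurable K (Measure.map (Prod.map (Prod.swap : β × α → α × β) (id : γ × (δ × ε) → γ × (δ × ε)))
        ((μb.prod μa).prod (μc.prod (μd.prod μe)))) := by
      rw [hS.map_eq]; exact hK.aestronglyMeasurable
    rw [← hS.map_eq, integral_map hS.measurable.aemeasurable hm]
    rfl
  rw [e1, integral_prod _ hK', integral_prod _ hK'.integral_prod_left]
  refine integral_congr_ae ?_
  filter_upwards [ae_ae_of_ae_prod hK'.prod_right_ae] with y hy
  refine integral_congr_ae ?_
  filter_upwards [hy] with x hx
  exact integral_prod₃_swap hx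

end Fubini

/-! ## §2 The change of variables (5.3.1) for a general integrand; `IsRDG ↔ IsDT` -/

section Passage

variable {ι : Type*} {terms : Finset ι} {ν : Measure (GaugeField P k U1)} [IsProbabilityMeasure ν]

/-- **THE CHANGE OF VARIABLES (5.3.1) WITH CUT-OFF FOR A GENERAL INTEGRAND, in the order of `IsDT`**: for a substitution-invariant probability law
`ν` of `u` and a `fieldsMeasure ν`-integrable `H(u, {u^{(j)}}, φ, ψ)`, `∫ν(du)∫Π𝒟u^{(j)}∫𝒟φ∫dψ H(u, ·) = ∫dv′ ∫ν(du) ∫Π𝒟u^{(j)} ∫dψ ∫𝒟φ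
H(u′_Λ(u)·Q^{s*}(cutoff_Λ v′), {u^{(j)}}, φ, ψ)` (gen 7's measure-preserving `(u, v′) ↦ u′_Λ(u)·Q^{s*}(cutoff_Λ v′)` on `ν ⊗ dv′`, Fubini in the
two orders; standing range). [cite: BalabanImbrieJaffe1988, (5.3.1) p.280] -/
theorem integral_fields_eq_iter_translCut (hk : k + 1 ≤ P.m + P.K) (hν : ∀ w, ν.map (fun U => surfMul U w) = ν) (Λ : Finset (PBond P (k+1)))
    {E : Type*} [NormedAddCommGroup E] [NormedSpace ℝ E] {H : Fields P k → E} (hH : Integrable H (fieldsMeasure ν)) :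
    ∫ U, ∫ prev, ∫ φ, ∫ ψ, H (U, (prev, (φ, ψ))) ∂volume ∂volume ∂prevMeasure P k ∂ν =
      ∫ v', ∫ U, ∫ prev, ∫ ψ, ∫ φ, H (surfMul (uCut qU Λ U) (cutoff Λ v'), (prev, (φ, ψ)))
        ∂volume ∂volume ∂prevMeasure P k ∂ν ∂fieldMeasure P (k+1) U1 := by
  -- the translation on the first factor, the identity on the others
  set M : Measure (Prev P k × (HiggsField P k × HiggsField P (k+1))) :=
    (prevMeasure P k).prod ((volume : Measure (HiggsField P k)).prod (volume : Measure (HiggsField P (k+1)))) with hM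
  have hT : MeasurePreserving
      (fun q : (GaugeField P k U1 × GaugeField P (k+1) U1) × (Prev P k × (HiggsField P k × HiggsField P (k+1))) =>
        ((surfMul (uCut qU Λ q.1.1) (cutoff Λ q.1.2), q.2) : Fields P k))
      ((ν.prod (fieldMeasure P (k+1) U1)).prod M) (fieldsMeasure ν) := by
    have h := (measurePreserving_translCut (Λ := Λ) hk hν).prod (MeasurePreserving.id M)
    unfold fieldsMeasure
    exact h
  -- the pulled-back integrand is integrable, and its integral is that of `H`
  have hK : Integrable (fun q : (GaugeField P k U1 × GaugeField P (k+1) U1) × (Prev P k × (HiggsField P k × HiggsField P (k+1))) =>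
      H (surfMul (uCut qU Λ q.1.1) (cutoff Λ q.1.2), q.2)) ((ν.prod (fieldMeasure P (k+1) U1)).prod M) :=
    (hT.integrable_comp hH.aestronglyMeasurable).2 hH
  have e1 : ∫ q, H q ∂fieldsMeasure ν =
      ∫ q, H (surfMul (uCut qU Λ q.1.1) (cutoff Λ q.1.2), q.2) ∂(ν.prod (fieldMeasure P (k+1) U1)).prod M := by
    have hm : AEStronglyMeasurable H (Measure.map
        (fun q : (GaugeField P k U1 × GaugeField P (k+1) U1) × (Prev P k × (HiggsField P k × HiggsField P (k+1))) =>
          ((surfMul (uCut qU Λ q.1.1) (cutoff Λ q.1.2), q.2) : Fields P k)) ((ν.prod (fieldMeasure P (k+1) U1)).prod M)) := by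
      rw [hT.map_eq]; exact hH.aestronglyMeasurable
    rw [← hT.map_eq, integral_map hT.measurable.aemeasurable hm]
  rw [← integral_fieldsMeasure hH, e1, hM, integral_prod₅_swap hK]

variable {Λ : ι → Finset (PBond P (k+1))}
variable {G : ι → Prev P k → GaugeField P k U1 → HiggsField P k → HiggsField P (k+1) → ℂ}
variable {J : ι → Prev P k → GaugeField P k U1 → GaugeField P (k+1) U1 → HiggsField P k → HiggsField P (k+1) → ℂ}
variable {ρL : GaugeField P (k+1) U1 → HiggsField P (k+1) → ℂ}

/-- kernel: one term of `IsRDG`, tested, equals the corresponding term of `IsDT` with `J_t = G_t` read in the translated variables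
(`integral_fields_eq_iter_translCut` for `G_t·g(Qu, ψ)`, and (5.3.6) `Q(u′_Λ·Q^{s*}(cutoff v′)) = v_Λ(u, v′)` in the test function).
[cite: BalabanImbrieJaffe1988, (5.3.6) p.280] -/
theorem term_test_eq_translCut (hk : k + 1 ≤ P.m + P.K) (hν : ∀ w, ν.map (fun U => surfMul U w) = ν) (Λ₀ : Finset (PBond P (k+1)))
    {G₀ : Prev P k → GaugeField P k U1 → HiggsField P k → HiggsField P (k+1) → ℂ}
    (hGi : Integrable (fun q : Fields P k => G₀ q.2.1 q.1 q.2.2.1 q.2.2.2) (fieldsMeasure ν))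
    {g : GaugeField P (k+1) U1 × HiggsField P (k+1) → ℂ} (hg : Measurable g) {C : ℝ} (hC : ∀ z, ‖g z‖ ≤ C) :
    ∫ U, ∫ prev, ∫ φ, ∫ ψ, G₀ prev U φ ψ * g (qU U, ψ) ∂volume ∂volume ∂prevMeasure P k ∂ν =
      ∫ v', ∫ U, ∫ prev, ∫ ψ, ∫ φ, G₀ prev (surfMul (uCut qU Λ₀ U) (cutoff Λ₀ v')) φ ψ * g (vCut qU Λ₀ U v', ψ)
        ∂volume ∂volume ∂prevMeasure P k ∂ν ∂fieldMeasure P (k+1) U1 := by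
  set H : Fields P k → ℂ := fun q => G₀ q.2.1 q.1 q.2.2.1 q.2.2.2 * g (qU q.1, q.2.2.2) with hHdef
  have hgm : Measurable fun q : Fields P k => g (qU q.1, q.2.2.2) :=
    hg.comp ((measurable_qU.comp measurable_fst).prodMk (measurable_snd.comp (measurable_snd.comp measurable_snd)))
  have hH : Integrable H (fieldsMeasure ν) := hGi.mul_bdd hgm.aestronglyMeasurable (Filter.Eventually.of_forall fun q => hC _)
  have key := integral_fields_eq_iter_translCut hk hν Λ₀ hH
  simp only [hHdef] at key
  rw [key]
  simp only [qU_translCut' hk]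

/-- **`IsRDG ⇒ IsDT`: LINE 1 OF (5.9.6) FROM THE UNTRANSLATED ONE-INTEGRAND DISPLAY** — the first gauge field translation (5.3.1) with its cut-off
(5.3.6) for a general integrand: `J_t({u^{(j)}}, u′, v, φ, ψ) := G_t({u^{(j)}}, u′·Q^{s*}(cutoff_{Λ_t} v), φ, ψ)` (the old integrand read in the new
variables).  Hypotheses: `ν` a substitution-invariant probability law (`𝒟u`, `𝒟u δ_{Ax}`), the printed `Qu`, every `G_t` `fieldsMeasure ν`-integrable,
standing range; any cut-offs `Λ_t`. [cite: BalabanImbrieJaffe1988, (5.3.6) p.280] -/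
theorem isDT_of_isRDG (hk : k + 1 ≤ P.m + P.K) (hν : ∀ w, ν.map (fun U => surfMul U w) = ν) (h : IsRDG ν terms qU G ρL)
    (hGi : ∀ t ∈ terms, Integrable (fun q : Fields P k => G t q.2.1 q.1 q.2.2.1 q.2.2.2) (fieldsMeasure ν)) (Λ : ι → Finset (PBond P (k+1))) :
    IsDT ν terms Λ qU (fun t prev u' v φ ψ => G t prev (surfMul u' (cutoff (Λ t) v)) φ ψ) ρL := by
  intro g hg hb
  obtain ⟨C, hC⟩ := hb
  rw [h g hg ⟨C, hC⟩]
  refine Finset.sum_congr rfl fun t ht => ?_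
  rw [term_test_eq_translCut hk hν (Λ t) (hGi t ht) hg hC]
  simp only [cutoff_vCut]

/-- **`IsDT ⇒ IsRDG`**: conversely a density satisfying line 1 of (5.9.6) for an integrand `J_t` satisfies the untranslated display with
`G_t({u^{(j)}}, u, φ, ψ) := J_t({u^{(j)}}, u′_{Λ_t}(u), Qu, φ, ψ)` — provided these `G_t` are `fieldsMeasure ν`-integrable (same hypotheses otherwise).
[cite: BalabanImbrieJaffe1988, (5.3.6) p.280] -/
theorem isRDG_of_isDT (hk : k + 1 ≤ P.m + P.K) (hν : ∀ w, ν.map (fun U => surfMul U w) = ν) (h : IsDT ν terms Λ qU J ρL)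
    (hJi : ∀ t ∈ terms, Integrable (fun q : Fields P k => J t q.2.1 (uCut qU (Λ t) q.1) (qU q.1) q.2.2.1 q.2.2.2) (fieldsMeasure ν)) :
    IsRDG ν terms qU (fun t prev U φ ψ => J t prev (uCut qU (Λ t) U) (qU U) φ ψ) ρL := by
  intro g hg hb
  obtain ⟨C, hC⟩ := hb
  rw [h g hg ⟨C, hC⟩]
  refine Finset.sum_congr rfl fun t ht => ?_
  rw [term_test_eq_translCut hk hν (Λ t) (hJi t ht) hg hC]
  simp only [uCut_translCut hk, qU_translCut' hk]

/-- **`IsDT ⇔ IsRDG`** for integrands of the translated form (both integrability hypotheses being the same function). [cite: BalabanImbrieJaffe1988, (5.3.6) p.280] -/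
theorem isRDG_iff_isDT (hk : k + 1 ≤ P.m + P.K) (hν : ∀ w, ν.map (fun U => surfMul U w) = ν)
    (hGi : ∀ t ∈ terms, Integrable (fun q : Fields P k => G t q.2.1 q.1 q.2.2.1 q.2.2.2) (fieldsMeasure ν)) (Λ : ι → Finset (PBond P (k+1))) :
    IsRDG ν terms qU G ρL ↔ IsDT ν terms Λ qU (fun t prev u' v φ ψ => G t prev (surfMul u' (cutoff (Λ t) v)) φ ψ) ρL := by
  refine ⟨fun h => isDT_of_isRDG hk hν h hGi Λ, fun h => ?_⟩
  have h' := isRDG_of_isDT hk hν h (fun t ht => by simpa only [translCut_uCut_qU] using hGi t ht)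
  exact h'.congr fun t _ prev U φ ψ => by simp only [translCut_uCut_qU]

/-- **Gen 8's display ⇒ line 1 of (5.9.6)** with the integrand `J_t = ρ_t·gaussWeight_a(Q_tφ, ψ)` read in the translated variables — the
§§5.1–5.3 density in the shape of (5.9.6) (for `ν = 𝒟u δ_{Ax}`: gen 8's `density528` is such an `IsRD`). [cite: BalabanImbrieJaffe1988, (5.9.6) p.297] -/
theorem isDT_of_isRD (hk : k + 1 ≤ P.m + P.K) (hν : ∀ w, ν.map (fun U => surfMul U w) = ν)
    {Qφ : ι → Prev P k → GaugeField P k U1 → HiggsField P k → HiggsField P (k+1)} {a : ℝ}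
    {ρ : ι → Prev P k → GaugeField P k U1 → HiggsField P k → HiggsField P (k+1) → ℂ} (h : IsRD ν terms qU Qφ a ρ ρL)
    (hρi : ∀ t ∈ terms, Integrable
      (fun q : Fields P k => ρ t q.2.1 q.1 q.2.2.1 q.2.2.2 * (gaussWeight a (Qφ t q.2.1 q.1 q.2.2.1) q.2.2.2 : ℂ)) (fieldsMeasure ν))
    (Λ : ι → Finset (PBond P (k+1))) :
    IsDT ν terms Λ qU (fun t prev u' v φ ψ => ρ t prev (surfMul u' (cutoff (Λ t) v)) φ ψ *
      (gaussWeight a (Qφ t prev (surfMul u' (cutoff (Λ t) v)) φ) ψ : ℂ)) ρL :=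
  isDT_of_isRDG hk hν ((isRD_iff_isRDG Qφ a ρ ρL).1 h) hρi Λ

/-- Instance `ν = ∫𝒟u δ_{Ax}(u)(·)` (the measure of (5.9.6): gen 7's `axialMeasure_map_surfMul`). [cite: BalabanImbrieJaffe1988, (5.9.6) p.297] -/
theorem isDT_of_isRDG_axial (hk : k + 1 ≤ P.m + P.K) (h : IsRDG (axialMeasure P k U1) terms qU G ρL)
    (hGi : ∀ t ∈ terms, Integrable (fun q : Fields P k => G t q.2.1 q.1 q.2.2.1 q.2.2.2) (fieldsMeasure (axialMeasure P k U1)))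
    (Λ : ι → Finset (PBond P (k+1))) :
    IsDT (axialMeasure P k U1) terms Λ qU (fun t prev u' v φ ψ => G t prev (surfMul u' (cutoff (Λ t) v)) φ ψ) ρL :=
  isDT_of_isRDG hk axialMeasure_map_surfMul h hGi Λ

omit [IsProbabilityMeasure ν] in
/-- Instance `ν = 𝒟u` (r18's `map_surfMul_fieldMeasure`). [cite: BalabanImbrieJaffe1988, (5.3.6) p.280] -/
theorem isDT_of_isRDG_field (hk : k + 1 ≤ P.m + P.K) (h : IsRDG (fieldMeasure P k U1) terms qU G ρL)
    (hGi : ∀ t ∈ terms, Integrable (fun q : Fields P k => G t q.2.1 q.1 q.2.2.1 q.2.2.2) (fieldsMeasure (fieldMeasure P k U1)))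
    (Λ : ι → Finset (PBond P (k+1))) :
    IsDT (fieldMeasure P k U1) terms Λ qU (fun t prev u' v φ ψ => G t prev (surfMul u' (cutoff (Λ t) v)) φ ψ) ρL :=
  isDT_of_isRDG hk map_surfMul_fieldMeasure h hGi Λ

end Passage

end

end Literature.MathematicalPhysics.QuantumFieldTheory.BalabanImbrieJaffe1984to88.BIJ88Eq596Passage
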